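import Mathlib
import HarnessLib
import Literature.MathematicalPhysics.StatisticalMechanics.LinearisedMapLargePartNorm

/-!
# Lemma 10.2 for the DIFFERENCE of two step kernels: the large part of `(C_k^{(q)} − C_k^{(q')})K`
# ([ABKM19] Lemma 10.2 ⊗ Lemma 8.4 (`ℓ = 1`); Lemma 12.6 (12.53) preparation)

The linearisation `C_k K` of the renormalisation map contains the large part
`F(U) = Σ_{X ∈ 𝒫_k^c ∖ ℬ_k, π(X)=U} R_{k+1}K(X)` (`largePart`), bounded in Lemma 10.2
(`tayNormLE_largePart_fluct`) from the integration property of the step kernel.  For the Lipschitz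
dependence of the step on the kernel (hypothesis `hl` of Lemma 12.6, two-kernel twin of the chain —
see the crux memo G2-DONE-cgffstiff-g7 §3bis) one needs the same bound for the DIFFERENCE of the
large parts of two kernels `𝒞a, 𝒞b`, from the `ℓ = 1` integration property of the pair
(`IntegrationProperty`-shaped hypothesis `hdint` with constant `C·ℓ·κ^{|X|_k}`, supplied for the torus
data by `FluctuationKernelComparisonProperty.tayNormLE_fluct_sub_fluct_pow_abkm`):

* `largePart_sub` — `largePart s L R_a K U − largePart s L R_b K U = largePart s L (R_a − R_b) K U`;
* **`tayNormLE_largePart_fluct_sub`** — Lemma 10.2 for the pair: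
  `|F_a(U) − F_b(U)|_{k+1,U} ≤ C ℓ · ε(A, κ) · A^{−|U|_{k+1}}`, `ε = largePartEps d L A κ η`.

The proof is that of `tayNormLE_largePart_fluct` with `R = fluct 𝒞a − fluct 𝒞b` and `C ↦ Cℓ`.
Everything is proved; no named fact.

## References
* S. Adams, S. Buchholz, R. Kotecký, S. Müller, arXiv:1910.13564, Lemma 10.2, Lemma 8.4, Lemma 12.6
  (12.53) [AdamsBuchholzKoteckyMuller2019].
-/

noncomputable section

namespace Literature.MathematicalPhysics.StatisticalMechanics.GradientRG

open scoped BigOperators Classical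
open Finset MeasureTheory
open Literature.MathematicalPhysics.StatisticalMechanics.TorusPolymer
  (IsPolymer blocks numBlocks polys closure reblock thicken card_blocks_eq_numBlocks)
open Literature.Barriers.CriticalPhenomena.LongRangePhi4.Polymer (IsConn)
open Literature.MathematicalPhysics.QuantumFieldTheory

variable {d M : ℕ} [NeZero M]

/-- `largePart` is additive in the integration map: the difference of the large parts of two maps is
the large part of their difference. [cite: AdamsBuchholzKoteckyMuller2019, Ch. 10.1 (10.2)] -/
theorem largePart_sub (s L : ℕ) (Ra Rb : (((Fin d → ZMod M) → ℝ) → ℂ) → ((Fin d → ZMod M) → ℝ) → ℂ)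
    (K : Finset (Fin d → ZMod M) → ((Fin d → ZMod M) → ℝ) → ℂ) (U : Finset (Fin d → ZMod M)) :
    largePart s L Ra K U - largePart s L Rb K U =
      largePart s L (fun F φ => Ra F φ - Rb F φ) K U := by
  funext φ
  simp only [largePart, Pi.sub_apply, sum_sub_distrib]

/-- **Lemma 10.2 for the difference of two step kernels.**  Let `‖K‖_k^{(A)} ≤ C`, `K(X, ·)` local and
`C^{r₀}` with `C^{r₀}` fluctuation integrals under both kernels, the `ℓ = 1` integration property of
the pair with constants `ℓ ≥ 0`, `κ` (`hdint`), (w6), the scale relations of the gauges, `1 ≤ A`,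
`0 ≤ κ ≤ A`, `2^{L^d} κ A^{−(1−1/η)} ≤ 1` and the closure gain.  Then for every non-empty `(k+1)`-polymer
`U`: `|F_a(U) − F_b(U)|_{k+1,U,T_φ} ≤ C ℓ ε(A) A^{−|U|_{k+1}} w_{k+1}^U(φ)`.
[cite: AdamsBuchholzKoteckyMuller2019, Lemma 10.2 / Lemma 12.6 (12.53)] -/
theorem tayNormLE_largePart_fluct_sub (P : NormParams d M) {k t : ℕ} (hM : M = P.L ^ (k + 1) * t)
    (hL : Odd P.L) (ht : Odd t) (h𝔥 : 0 < P.𝔥 (k + 1)) (h𝔥le : P.𝔥 (k + 1) ≤ P.𝔥 k)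
    (hR : 0 < P.R k) (hRle : P.R k ≤ P.R (k + 1)) (hrad : P.rad k ≤ P.rad (k + 1))
    (hrad' : P.rad k + (2 ^ d - 1) * P.L ^ k ≤ P.rad (k + 1)) (hA : 1 ≤ P.A)
    {𝒞a 𝒞b : (Fin d → ZMod M) → ℝ} {κ η ℓ : ℝ} (hκ : 0 ≤ κ) (hκA : κ ≤ P.A) (hη : 0 < η) (hℓ : 0 ≤ ℓ)
    (hsmall : (2 : ℝ) ^ (P.L ^ d) * (κ * P.A ^ (-(1 - η⁻¹) : ℝ)) ≤ 1)
    (hgain : ∀ X : Finset (Fin d → ZMod M), IsPolymer (P.L ^ k) X → IsConn X →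
      2 ^ d < (blocks (P.L ^ k) X).card →
        η * ((blocks (P.L * P.L ^ k) (closure (P.L * P.L ^ k) X)).card : ℝ) ≤ (blocks (P.L ^ k) X).card)
    (hdint : ∀ X : Finset (Fin d → ZMod M), IsPolymer (P.L ^ k) X → IsConn X →
      ∀ (F : ((Fin d → ZMod M) → ℝ) → ℂ) (C : ℝ), 0 ≤ C → ContDiff ℝ P.r₀ F →
        IsGaugeLocal (P.gauge k X) F → TayNormLE (P.gauge k X) P.r₀ (P.W.weight k X) F C →
          TayNormLE (P.gauge k X) P.r₀ (P.W.midWeight k X) (fluct 𝒞a F - fluct 𝒞b F)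
            (C * ℓ * κ ^ numBlocks (P.L ^ k) X))
    (hw6 : NextWeightDominates P k)
    {K : Finset (Fin d → ZMod M) → ((Fin d → ZMod M) → ℝ) → ℂ} {C : ℝ} (hC : 0 ≤ C)
    (hK : WeakNormLE P k K C) (hKd : ∀ X, ContDiff ℝ P.r₀ (K X))
    (hKloc : ∀ X, IsPolymer (P.L ^ k) X → IsConn X → IsGaugeLocal (P.gauge k X) (K X))
    (hRa : ∀ X, ContDiff ℝ P.r₀ (fluct 𝒞a (K X))) (hRb : ∀ X, ContDiff ℝ P.r₀ (fluct 𝒞b (K X)))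
    {U : Finset (Fin d → ZMod M)} (hU : IsPolymer (P.L ^ (k + 1)) U) (hUne : U.Nonempty) :
    TayNormLE (P.gauge (k + 1) U) P.r₀ (P.W.weight (k + 1) U)
      (largePart (P.L ^ k) P.L (fluct 𝒞a) K U - largePart (P.L ^ k) P.L (fluct 𝒞b) K U)
      (C * ℓ * largePartEps d P.L P.A κ η * P.aFactor (k + 1) U) := by
  have hLs : P.L * P.L ^ k = P.L ^ (k + 1) := (pow_succ' P.L k).symm
  have hM' : M = P.L * P.L ^ k * t := hM.trans (by rw [hLs])
  have hMk : M = P.L ^ k * (P.L * t) := hM.trans (by rw [pow_succ]; ring)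
  have hA0 : 0 < P.A := by linarith
  rw [largePart_sub]
  set Rd : (((Fin d → ZMod M) → ℝ) → ℂ) → ((Fin d → ZMod M) → ℝ) → ℂ :=
    fun F φ => fluct 𝒞a F φ - fluct 𝒞b F φ with hRd_def
  have hRdK : ∀ X, Rd (K X) = fluct 𝒞a (K X) - fluct 𝒞b (K X) := fun X => by
    funext φ; simp only [hRd_def, Pi.sub_apply]
  have hRdd : ∀ X, ContDiff ℝ P.r₀ (Rd (K X)) := fun X => by rw [hRdK]; exact (hRa X).sub (hRb X)
  -- the per-polymer bounds at the target gauge and weight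
  have hper : ∀ X ∈ largePartIndex (P.L ^ k) P.L U,
      TayNormLE (P.gauge (k + 1) U) P.r₀ (P.W.weight (k + 1) U) (Rd (K X))
        (C * ℓ * (κ ^ (blocks (P.L ^ k) X).card * (P.A ^ (blocks (P.L ^ k) X).card)⁻¹)) := by
    intro X hX
    obtain ⟨hP, hc, -, hr⟩ := mem_largePartIndex.1 hX
    -- Lemma 8.4 (`ℓ = 1`): `‖(R_a − R_b) K(X)‖_{k:k+1,X} ≤ C A^{-|X|} ℓ κ^{|X|}`
    have h1 := hdint X hP hc (K X) (C * P.aFactor k X)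
      (mul_nonneg hC (WeakNormLE.aFactor_pos hA0 k X).le) (hKd X) (hKloc X hP hc) (hK X hP hc)
    -- locality of the fluctuation integrals for the scale-`k` gauge
    have hloca : IsGaugeLocal (P.gauge k X) (fluct 𝒞a (K X)) :=
      isGaugeLocal_integral (P.gauge k X) (stepMeasure 𝒞a) fun ξ => (hKloc X hP hc).comp_add_right _ ξ
    have hlocb : IsGaugeLocal (P.gauge k X) (fluct 𝒞b (K X)) :=
      isGaugeLocal_integral (P.gauge k X) (stepMeasure 𝒞b) fun ξ => (hKloc X hP hc).comp_add_right _ ξ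
    have hloc : IsGaugeLocal (P.gauge k X) (Rd (K X)) := fun φ ψ hφψ => by
      rw [hRdK]
      simp only [Pi.sub_apply]
      rw [hloca φ ψ hφψ, hlocb φ ψ hφψ]
    -- Lemma 8.1: pass to the gauge of `U = π(X)` at scale `k+1`
    have h2 : TayNormLE (P.gauge (k + 1) U) P.r₀ (P.W.midWeight k X) (Rd (K X))
        (C * P.aFactor k X * ℓ * κ ^ numBlocks (P.L ^ k) X) := by
      rw [hRdK]
      refine h1.of_le_gauge (fun ξ => ?_) ((hRa X).sub (hRb X)) (hRdK X ▸ hloc)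
      rw [← hr]
      exact norm_gauge_le_norm_gauge_succ P hMk hL (hL.mul ht) h𝔥 h𝔥le hR hRle hrad hrad' X ξ
    -- (w6): pass to the weight `w_{k+1}^U`
    have hc0 : 0 ≤ C * P.aFactor k X * ℓ * κ ^ numBlocks (P.L ^ k) X :=
      mul_nonneg (mul_nonneg (mul_nonneg hC (WeakNormLE.aFactor_pos hA0 k X).le) hℓ) (pow_nonneg hκ _)
    have h3 : TayNormLE (P.gauge (k + 1) U) P.r₀ (P.W.weight (k + 1) U) (Rd (K X))
        (C * P.aFactor k X * ℓ * κ ^ numBlocks (P.L ^ k) X) :=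
      h2.mono_weight hc0 fun φ => by rw [← hr]; exact hw6 X hP hc φ
    refine h3.mono (le_of_eq ?_) fun φ => (P.W.weight_pos (k + 1) U φ).le
    rw [NormParams.aFactor, ← card_blocks_eq_numBlocks]; ring
  have hmain := tayNormLE_largePart hM' (hL.pow) hL ht (P.gauge (k + 1) U)
    (w := P.W.weight (k + 1) U) (fun φ => (P.W.weight_pos (k + 1) U φ).le) (R := Rd) (K := K)
    hA hκ hκA hη (mul_nonneg hC hℓ) hsmall hgain (by rwa [hLs]) hUne (fun X _ => hRdd X) hper
  refine hmain.mono (le_of_eq ?_) fun φ => (P.W.weight_pos (k + 1) U φ).le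
  rw [NormParams.aFactor, ← card_blocks_eq_numBlocks, hLs]

end Literature.MathematicalPhysics.StatisticalMechanics.GradientRG

end
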